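import Summits.AtomisticToContinuum.BoseEinsteinCondensation.Theses.BECInsertionCorrector
import Summits.AtomisticToContinuum.BoseEinsteinCondensation.Theorems.BECInsertionCorrectorCorrectorClosureSplit
import Summits.AtomisticToContinuum.BoseEinsteinCondensation.Theorems.BECInsertionCorrectorCorrectorClosureFactorisationExact
import Summits.AtomisticToContinuum.BoseEinsteinCondensation.Theorems.CorrectorClosure.Negative.InsertionResidueLoadBearing
import HarnessLib

/-!
# Strategy census s2 (independent) — typed attempts for crux `CorrectorClosure`
(stmt-AtomisticToContinuum-12058, route BECInsertionCorrector).

Scratch file of the strategist seat `cstrat-stmt-AtomisticToContinuum-12058-s2`; nothing here is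
proposed to the tree. Every `theorem` is sorry-free; the `def`s are the candidate intermediates /
pieces / strengthenings discussed in `STRATEGY-CENSUS-s2.md`.
-/

open MeasureTheory Filter Matrix
open scoped ENNReal NNReal BigOperators ComplexConjugate

namespace Summit.AtomisticToContinuum.BoseEinsteinCondensation.Cruxes.CorrectorClosure.CensusS2

open Literature.MathematicalPhysics.QuantumManyBody.BoseGas
open Summit.AtomisticToContinuum.BoseEinsteinCondensation.Theses.BECInsertionCorrector
open Summit.AtomisticToContinuum.BoseEinsteinCondensation.Theorems.CorrectorClosure

/-! ## §0 The pieces, named -/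

/-- Torus BEC of near-minimisers for ONE admissible `v` (body of item stmt-8997 `PeriodicBEC`,
the hypothesis `BoundaryTransferWeak` consumes at `v`). -/
def PeriodicBECAt (v : ℝ → ℝ≥0∞) : Prop :=
  ∃ ρ₀ : ℝ, 0 < ρ₀ ∧ ∀ ρ : ℝ, 0 < ρ → ρ < ρ₀ → ∃ c : ℝ, 0 < c ∧ ∀ᶠ N : ℕ in Filter.atTop,
    ∃ δ : ℝ≥0∞, 0 < δ ∧ ∀ Ψ : PeriodicTrialState N (sideLength ρ N),
      periodicEnergy v Ψ ≤ periodicGroundStateEnergy v N (sideLength ρ N) + δ →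
      ENNReal.ofReal (c * N) ≤ condensateOccupation N (sideLength ρ N) Ψ.ψ

/-- Torus BEC for every admissible `v` (= item stmt-8997 verbatim). -/
def PeriodicBECAll : Prop := ∀ v : ℝ → ℝ≥0∞, IsRepulsiveFiniteRange v → PeriodicBECAt v

/-- Insertion-residue floor for ONE admissible `v` (body of the target `InsertionResidue`). -/
def InsertionResidueAt (v : ℝ → ℝ≥0∞) : Prop :=
  ∃ ρ₀ : ℝ, 0 < ρ₀ ∧ ∀ ρ : ℝ, 0 < ρ → ρ < ρ₀ → ∃ c : ℝ, 0 < c ∧ ∀ᶠ N : ℕ in Filter.atTop,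
    ∃ δ : ℝ≥0∞, 0 < δ ∧ ∃ Θ : PeriodicTrialState N (sideLength ρ (N + 1)),
      periodicEnergy v Θ ≤ periodicGroundStateEnergy v N (sideLength ρ (N + 1)) + δ ∧
      ∀ Ψ : PeriodicTrialState (N + 1) (sideLength ρ (N + 1)),
        periodicEnergy v Ψ ≤ periodicGroundStateEnergy v (N + 1) (sideLength ρ (N + 1)) + δ →
        ENNReal.ofReal c ≤ ENNReal.ofReal ((sideLength ρ (N + 1) ^ 3)⁻¹) *
          (‖∫ X in cellN N (sideLength ρ (N + 1)), conj (Θ.ψ X) *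
              ∫ x in cell (sideLength ρ (N + 1)), Ψ.ψ (vecCons x X)‖₊ : ℝ≥0∞) ^ 2

theorem insertionResidue_iff : InsertionResidue ↔ ∀ v, IsRepulsiveFiniteRange v → InsertionResidueAt v :=
  Iff.rfl

theorem correctorClosure_iff :
    CorrectorClosure ↔ (StaticResponseBound → ∀ v, IsRepulsiveFiniteRange v → InsertionResidueAt v) :=
  Iff.rfl

/-! ## §1 Weakest intermediate that can replace the crux in `closes` -/

/-- `W` := K1 → torus BEC for every admissible `v`. -/
def PeriodicBECOfSRB : Prop := StaticResponseBound → PeriodicBECAll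

/-- `CorrectorClosure → W` (landed necessity `periodicBEC_of_correctorClosure`, p121285). -/
theorem periodicBECOfSRB_of_correctorClosure (hCC : CorrectorClosure) : PeriodicBECOfSRB :=
  fun hK1 => ResidueAreaLaw.periodicBEC_of_correctorClosure hCC hK1

/-- `W` replaces `CorrectorClosure` (and `ResidueCondenses`) in the route's deciding theorem. -/
theorem closes_of_W (h₁ : StaticResponseBound) (hW : PeriodicBECOfSRB) (h₄ : BoundaryTransferWeak) :
    _root_.BoseEinsteinCondensation :=
  fun v hv => h₄ v hv (hW h₁ v hv)

/-- … and the route's own use of the crux factors through `W`: nothing weaker than `W` is consumed. -/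
theorem closes_via_W (h₁ : StaticResponseBound) (h₂ : CorrectorClosure) (h₄ : BoundaryTransferWeak) :
    _root_.BoseEinsteinCondensation :=
  closes_of_W h₁ (periodicBECOfSRB_of_correctorClosure h₂) h₄

/-- Pointwise-in-`v` weakest intermediate: for each admissible `v`, K1 ⇒ torus BEC at `v`.
Equivalent to `W` (K1 is `v`-uniform as typed). -/
theorem periodicBECOfSRB_iff_pointwise :
    PeriodicBECOfSRB ↔ ∀ v, IsRepulsiveFiniteRange v → StaticResponseBound → PeriodicBECAt v :=
  ⟨fun h v hv hK1 => h hK1 v hv, fun h hK1 v hv => h v hv hK1⟩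

/-! ## §2 Decomposition: the exact split modulo K1 (landed, proposal 169803) -/

/-- Child 2 of the split: given K1, torus BEC at `v` ⇒ insertion-residue floor at `v`. -/
def InsertionResidueOfBEC : Prop :=
  StaticResponseBound → ∀ v : ℝ → ℝ≥0∞, IsRepulsiveFiniteRange v → PeriodicBECAt v → InsertionResidueAt v

/-- Assembly of the split, by name (landed `Split.CorrectorClosure_of_subs`). -/
theorem correctorClosure_of_pieces (hP : PeriodicBECAll) (hB : InsertionResidueOfBEC) : CorrectorClosure :=
  Split.CorrectorClosure_of_subs hP hB

/-- Exactness: under K1 the crux IS the conjunction of the two pieces (landed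
`Split.correctorClosure_iff_of_staticResponseBound`). -/
theorem correctorClosure_iff_pieces (hK1 : StaticResponseBound) :
    CorrectorClosure ↔ (PeriodicBECAll ∧ InsertionResidueOfBEC) :=
  Split.correctorClosure_iff_of_staticResponseBound hK1

/-- Hence piece 1 is as strong as `W` outright, and `W` is all the route consumes: the hard piece of
the only exact split is the weakest admissible intermediate itself. -/
theorem W_of_piece1 (hP : PeriodicBECAll) : PeriodicBECOfSRB := fun _ => hP

/-! ## §3 Strengthenings considered (typed; none filed) -/

/-- S⁺(a): the `∀ Θ` form of the residue (every `N`-body near-minimiser works as anchor). -/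
def InsertionResidueAllAnchors : Prop :=
  ∀ v : ℝ → ℝ≥0∞, IsRepulsiveFiniteRange v →
  ∃ ρ₀ : ℝ, 0 < ρ₀ ∧ ∀ ρ : ℝ, 0 < ρ → ρ < ρ₀ → ∃ c : ℝ, 0 < c ∧ ∀ᶠ N : ℕ in Filter.atTop,
    ∃ δ : ℝ≥0∞, 0 < δ ∧ ∀ Θ : PeriodicTrialState N (sideLength ρ (N + 1)),
      periodicEnergy v Θ ≤ periodicGroundStateEnergy v N (sideLength ρ (N + 1)) + δ →
      ∀ Ψ : PeriodicTrialState (N + 1) (sideLength ρ (N + 1)),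
        periodicEnergy v Ψ ≤ periodicGroundStateEnergy v (N + 1) (sideLength ρ (N + 1)) + δ →
        ENNReal.ofReal c ≤ ENNReal.ofReal ((sideLength ρ (N + 1) ^ 3)⁻¹) *
          (‖∫ X in cellN N (sideLength ρ (N + 1)), conj (Θ.ψ X) *
              ∫ x in cell (sideLength ρ (N + 1)), Ψ.ψ (vecCons x X)‖₊ : ℝ≥0∞) ^ 2

/-- S⁺(c): thermodynamic-scale COERCIVITY of the excitation number (the induction-friendly form:
energy above the ground state controls depletion beyond a fraction `ε`, with the torus kinetic gap
`(2π/L)²` as exchange rate). Implies torus BEC of near-minimisers with `δ = κ ε N (2π/L)² / 2`. -/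
def ThermodynamicCoercivity : Prop :=
  ∀ v : ℝ → ℝ≥0∞, IsRepulsiveFiniteRange v → ∀ ε : ℝ, 0 < ε →
  ∃ ρ₀ : ℝ, 0 < ρ₀ ∧ ∀ ρ : ℝ, 0 < ρ → ρ < ρ₀ → ∃ κ : ℝ, 0 < κ ∧ ∀ᶠ N : ℕ in Filter.atTop,
    ∀ Ψ : PeriodicTrialState N (sideLength ρ N), periodicEnergy v Ψ ≠ ⊤ →
      κ * (2 * Real.pi / sideLength ρ N) ^ 2 *
          ((N : ℝ) - (condensateOccupation N (sideLength ρ N) Ψ.ψ).toReal - ε * N) ≤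
        (periodicEnergy v Ψ).toReal - (periodicGroundStateEnergy v N (sideLength ρ N)).toReal

/-! ## §4 Negation: shape of a counterexample -/

/-- `¬ CorrectorClosure ↔ K1 ∧ ¬ InsertionResidue` (landed `Negative.not_correctorClosure_iff`):
a refutation must PROVE K1 in full and exhibit an admissible `v` violating the residue floor. -/
theorem not_correctorClosure_iff' : ¬ CorrectorClosure ↔ (StaticResponseBound ∧ ¬ InsertionResidue) :=
  Negative.not_correctorClosure_iff

/-- The counterexample half, unfolded: some admissible `v` with no residue floor at any density
window. Under K1 and child 2 of §2 this is `¬ PeriodicBECAt v` — non-condensation of a 3D dilute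
repulsive Bose gas. -/
theorem not_insertionResidue_iff :
    ¬ InsertionResidue ↔ ∃ v, IsRepulsiveFiniteRange v ∧ ¬ InsertionResidueAt v := by
  rw [insertionResidue_iff]; push Not; rfl

theorem not_periodicBECAt_of_counterexample (hK1 : StaticResponseBound) (hB : InsertionResidueOfBEC)
    {v : ℝ → ℝ≥0∞} (hv : IsRepulsiveFiniteRange v) (h : ¬ InsertionResidueAt v) : ¬ PeriodicBECAt v :=
  fun hP => h (hB hK1 v hv hP)

end Summit.AtomisticToContinuum.BoseEinsteinCondensation.Cruxes.CorrectorClosure.CensusS2
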